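import Summits.QuantumFields.BalabanUV.Beta.SecondOrderMixedModel

/-!
# `BalabanUV.Beta.SecondOrderSocketIdentification` — binder row D1, (L4): **THE ROW's TWO REMAINING hR LETTERS RE-TYPED AS PURE-SIGN STATEMENTS**
# against the socket models, and the candidate row table `vh₂SAn1` (β sub-cell, row BETA-an2 = BINDER-OWNERS row D1 OWNER, lineage an2 gen 20, K-N)

HONEST FRAMING (cell charter, verbatim): «discharging BetaPertH makes Balaban's UV stability UNCONDITIONAL — a real
constructive-QFT result; it is NOT the continuum limit and NOT the Clay problem.»  Neutral kernel algebra ([folklore] / [our object]); no statement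
of Bałaban's papers, no `[cite:]`, no `Prop` fact; no letter is proved here; instantiates no binder of the wall.  NOT D1, NOT `BetaPertH`, NOT continuum,
NOT Clay.

WHAT (`d + 1 = 4`, odd `Lc`, centred root `ρ_c`).  With the two socket models of this gen in the tree (`SecondOrderBorderModel.vh₂SModel` /
`Twall`, `SecondOrderMixedModel.Mmodel`), the letters an1 owes for ITS tables become statements WITHOUT CONTACT TERMS:
* §1 (generic algebra) `solves_iff_sub_invariant`: if `actB_α T₀ − T₀ = D_α` then `actB_α T − T = D_α ⟺ actB_α (T − T₀) = T − T₀`; the residual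
  form `solves_res_iff_sub`.
* §2 **`mixedPrim_iff_sub_Mmodel`**: for ANY mixed table `M` and residual family `RM₀`,
  `MixedPrim Lc ρ_c cΛ M RM₀ ⟺ ∀ α, actB_α (M − Mmodel) − (M − Mmodel) = RM₀ α` — an1's (W-LET-M₂) for `mixFFAt` is the statement that
  `mixFFAt ρ_c Lc − Mmodel Lc cΛ` is reflection-covariant up to its (odd, `LocStencilFM`) residual, NO contact term.
* §3 **`borderAt_zero_iff_sub_Twall`**: for ANY border table `T` and `cB ≠ 0`,
  `BorderAt Lc ρ_c cΛ cB γ T 0 ⟺ ∀ α κ u κ′ u′, (actB_α (cB•T − Twall) − (cB•T − Twall)) κ u κ′ u′ =fm= 0` — an1's (W-0B)sym for its table is the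
  statement that `cB•T_an1 − Twall` is reflection-INVARIANT on the field–multiplier block under all four axes.
* §4 [our object] the CANDIDATE ROW TABLE **`vh₂SAn1 Lc := atw ∘ (g,h)-symmetrisation of an1's `AveragingMixedJetTables.vh₂SAt ρ_c Lc`**
  (anti-twin packing of the symmetrised second-order border table — owner NOTE X-an2-46's prescription); `vh₂SAn1_inl_inl/_inr_inr/_antiTwin`;
  and the row's border letter AS A NAMED TARGET: `borderAt_zero_an1_iff`.
HONEST: nothing here asserts that `vh₂SAn1` or `mixFFAt` satisfy their letters; 0∕4 binders.
Provenance: β sub-cell, unit beta-an2 gen 20, 2026-08-20 (v1); no existing file touched.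
-/

open Finset
open scoped BigOperators
open Literature.MathematicalPhysics.QuantumFieldTheory
open Literature.MathematicalPhysics.QuantumFieldTheory.Balaban1983to89
open Literature.MathematicalPhysics.QuantumFieldTheory.Balaban1983to89.Beta
open ExpKernelCalculus (MKer)
open AffineAveraging (box toSite)
open AveragingContoursRooted (ctr ctrOff ctrOff_mem_box)
open AveragingHessianKernelsRooted (hessFFAt)
open AveragingMixedJetTables (vh₂SAt mixFFAt)
open PolarizationSign (reflSign)
open KernelReflection (refK refK_apply)
open ResolventReflection (bref Φ)
open OneStepResolventKernel (Fib)
open BalabanStepJetsSucc (wVH)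
open BalabanStepW2 (wB2)
open Summit.QuantumFields.BalabanUV.Beta.TameKernelCalculus
open Summit.QuantumFields.BalabanUV.Beta.ChartConjugation (conjV conjW)
open Summit.QuantumFields.BalabanUV.Beta.BorderedHessian (diagK ctGen bhKStepAt stepScale)
open Summit.QuantumFields.BalabanUV.Beta.SpineRooted (SpureRecAt)
open Summit.QuantumFields.BalabanUV.Beta.SecondOrderBorderGauge
open Summit.QuantumFields.BalabanUV.Beta.SecondOrderBorderGaugeWall (wallD₀ wallD₀_eq)
open Summit.QuantumFields.BalabanUV.Beta.SecondOrderBorderCocycle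
open Summit.QuantumFields.BalabanUV.Beta.SecondOrderBorderModel (Bwall Twall Twall_solves vh₂SModel)
open Summit.QuantumFields.BalabanUV.Beta.SecondOrderMixedModel (Dmix Mmodel Mmodel_solves)
open Summit.QuantumFields.BalabanUV.Beta.SecondOrderLetterLevels (BorderAt MixedPrim)

namespace Summit.QuantumFields.BalabanUV.Beta.SecondOrderSocketIdentification

noncomputable section

variable {d : ℕ}

/-! ## §1 Solutions of an affine reflection equation differ from a model by an invariant -/

/-- [folklore] **AFFINE ⇒ INVARIANT**: if `T₀` solves `actB_α T₀ − T₀ = D` then `T` solves it iff `T − T₀` is `actB_α`-invariant. -/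
theorem solves_iff_sub_invariant {N : ℕ} {α : Fin (d + 1)}
    {T T₀ D : Fin (d + 1) → (Fin (d + 1) → ℤ) → Fin (d + 1) → (Fin (d + 1) → ℤ) → MKer (d + 1) (Fib d)} (h₀ : actB N α T₀ - T₀ = D) :
    actB N α T - T = D ↔ actB N α (T - T₀) - (T - T₀) = 0 := by
  rw [actB_sub, ← h₀]
  constructor
  · intro h; rw [show actB N α T - actB N α T₀ - (T - T₀) = (actB N α T - T) - (actB N α T₀ - T₀) by abel, h, sub_self]
  · intro h
    have : (actB N α T - T) - (actB N α T₀ - T₀) = 0 := by rw [← h]; abel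
    exact sub_eq_zero.mp this

/-- [folklore] The residual form: if `T₀` solves `actB_α T₀ − T₀ = D` then `actB_α T − T = D + R ⟺ actB_α (T − T₀) − (T − T₀) = R`. -/
theorem solves_res_iff_sub {N : ℕ} {α : Fin (d + 1)}
    {T T₀ D R : Fin (d + 1) → (Fin (d + 1) → ℤ) → Fin (d + 1) → (Fin (d + 1) → ℤ) → MKer (d + 1) (Fib d)} (h₀ : actB N α T₀ - T₀ = D) :
    actB N α T - T = D + R ↔ actB N α (T - T₀) - (T - T₀) = R := by
  rw [actB_sub, ← h₀]
  constructor
  · intro h; rw [show actB N α T - actB N α T₀ - (T - T₀) = (actB N α T - T) - (actB N α T₀ - T₀) by abel, h]; abel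
  · intro h
    rw [show actB N α T - T = (actB N α T - actB N α T₀ - (T - T₀)) + (actB N α T₀ - T₀) by abel, h]; abel

/-! ## §2 The mixed letter as a pure-sign statement against `Mmodel` -/

section Wall

variable {Lc : ℕ} [NeZero Lc]

/-- [folklore] **THE MIXED LETTER (M₀) ⟺ REFLECTION COVARIANCE OF `M − Mmodel` UP TO THE RESIDUAL**: for any mixed table `M` and residual family
`RM₀`, `MixedPrim Lc ρ_c cΛ M RM₀ ⟺ ∀ α, actB_α (M − Mmodel Lc cΛ) − (M − Mmodel Lc cΛ) = RM₀ α`. -/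
theorem mixedPrim_iff_sub_Mmodel (hLc : Odd Lc) (cΛ : ℝ) (M : Fin 4 → (Fin 4 → ℤ) → Fin 4 → (Fin 4 → ℤ) → MKer 4 (Fib 3))
    (RM₀ : Fin 4 → Fin 4 → (Fin 4 → ℤ) → Fin 4 → (Fin 4 → ℤ) → MKer 4 (Fib 3)) :
    MixedPrim Lc (toSite (ctrOff 4 Lc)) cΛ M RM₀ ↔ ∀ α : Fin 4, actB Lc α (M - Mmodel Lc cΛ) - (M - Mmodel Lc cΛ) = RM₀ α := by
  -- (M₀) for axis `α` is `actB_α M − M = Dmix_α + RM₀ α`, entry by entry (`letter_iff_actB` at every leg pair)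
  have key : ∀ α : Fin 4, (∀ (κ : Fin 4) (u : Fin 4 → ℤ) (ρ' : Fin 4) (w : Fin 4 → ℤ),
      M κ (bref α κ u) ρ' (bref α ρ' w) = (reflSign α κ * reflSign α ρ') • refK (Φ Lc α)
        (M κ u ρ' w + conjV (cΛ • hessFFAt (toSite (ctrOff 4 Lc)) Lc ρ' w) (diagK fun p c => -((Lc : ℝ) ^ 4 / 2) * ctGen 3 α Lc κ u p c) +
          RM₀ α κ u ρ' w)) ↔ actB Lc α M - M = Dmix Lc cΛ α + RM₀ α := by
    intro α
    constructor
    · intro h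
      funext κ u ρ' w x z a b
      have h2 := (letter_iff_actB Lc α M (Dmix Lc cΛ α + RM₀ α) κ u ρ' w a b).1 (fun x z => by
        rw [h κ u ρ' w, add_assoc]; rfl) x z
      exact h2
    · intro h κ u ρ' w
      funext x z a b
      have e := congrFun (congrFun (congrFun (congrFun h κ) u) ρ') w
      simp only [Pi.sub_apply] at e
      have h2 := (letter_iff_actB Lc α M (Dmix Lc cΛ α + RM₀ α) κ u ρ' w a b).2 (fun x z => by rw [e]) x z
      rw [add_assoc]
      exact h2
  constructor
  · intro h α
    exact (solves_res_iff_sub (Mmodel_solves hLc cΛ α)).1 ((key α).1 (h α))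
  · intro h α
    exact (key α).2 ((solves_res_iff_sub (Mmodel_solves hLc cΛ α)).2 (h α))

/-! ## §3 The border letter as a pure-sign statement against `Twall` -/

/-- [folklore] **THE BORDER LETTER AT LEVEL 0 ⟺ `cB•T − Twall` IS REFLECTION-INVARIANT ON THE FIELD–MULTIPLIER BLOCK** (all four axes), `cB ≠ 0`. -/
theorem borderAt_zero_iff_sub_Twall (hLc : Odd Lc) (cΛ cB : ℝ) (γ : ℕ → ℝ)
    (hγ : ∀ j, γ j = -((Lc : ℝ) ^ 8 / 2) * wVH 3 Lc j / (stepScale 3 Lc j * (Lc : ℝ) ^ 4))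
    (T : Fin 4 → (Fin 4 → ℤ) → Fin 4 → (Fin 4 → ℤ) → MKer 4 (Fib 3)) :
    BorderAt Lc (toSite (ctrOff 4 Lc)) cΛ cB γ T 0 ↔
      ∀ (α κ : Fin 4) (u : Fin 4 → ℤ) (κ' : Fin 4) (u' x z : Fin 4 → ℤ) (β m : Fin 4),
        (actB Lc α (cB • T - Twall Lc cΛ γ) - (cB • T - Twall Lc cΛ γ)) κ u κ' u' x z (Sum.inl β) (Sum.inr m) = 0 := by
  have hw : wB2 3 Lc 0 = 1 := by simp [BalabanStepW2.wB2]
  have hsol := Twall_solves hLc cΛ γ hγ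
  -- both sides, axis by axis and bond pair by bond pair, are the `fm` entries of `actB_α (cB•T) − cB•T = wallD₀ α`
  have key : ∀ (α κ : Fin 4) (u : Fin 4 → ℤ) (κ' : Fin 4) (u' : Fin 4 → ℤ) (β m : Fin 4),
      (∀ x z : Fin 4 → ℤ, ((cB * wB2 3 Lc 0) • T κ (bref α κ u) κ' (bref α κ' u')) x z (Sum.inl β) (Sum.inr m) =
        ((reflSign α κ * reflSign α κ') • refK (Φ Lc α) ((cB * wB2 3 Lc 0) • T κ u κ' u' +
          conjW (bhKStepAt 3 (toSite (ctrOff 4 Lc)) Lc 0)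
            (SpureRecAt 3 Lc (toSite (ctrOff 4 Lc)) ((Lc : ℝ) ^ 4) (-((Lc : ℝ) ^ 8 / 2)) cΛ 0 κ u)
            (SpureRecAt 3 Lc (toSite (ctrOff 4 Lc)) ((Lc : ℝ) ^ 4) (-((Lc : ℝ) ^ 8 / 2)) cΛ 0 κ' u')
            (diagK fun p c => γ 0 * ctGen 3 α Lc κ u p c) (diagK fun p c => γ 0 * ctGen 3 α Lc κ' u' p c)
            (diagK fun p c => γ 0 ^ 2 * (ctGen 3 α Lc κ u p c * ctGen 3 α Lc κ' u' p c)))) x z (Sum.inl β) (Sum.inr m)) ↔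
      (∀ x z : Fin 4 → ℤ, (actB Lc α (cB • T - Twall Lc cΛ γ) - (cB • T - Twall Lc cΛ γ)) κ u κ' u' x z (Sum.inl β) (Sum.inr m) = 0) := by
    intro α κ u κ' u' β m
    rw [← wallD₀_eq, hw, mul_one]
    have h1 := letter_iff_actB Lc α (fun κ u κ' u' => cB • T κ u κ' u') (wallD₀ Lc cΛ γ α) κ u κ' u' (Sum.inl β) (Sum.inr m)
    rw [h1]
    have e := congrFun (congrFun (congrFun (congrFun (hsol α) κ) u) κ') u'
    rw [actB_sub, actB_smul]
    constructor
    · intro h x z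
      have hx := h x z
      have ex := congrFun (congrFun (congrFun (congrFun e x) z) (Sum.inl β)) (Sum.inr m)
      simp only [Pi.sub_apply, Pi.smul_apply] at hx ex ⊢
      rw [show actB Lc α (fun κ u κ' u' => cB • T κ u κ' u') = actB Lc α (cB • T) from rfl, actB_smul] at hx
      simp only [Pi.smul_apply, bdB_inl_inr, Bwall] at hx ex
      linarith
    · intro h x z
      have hx := h x z
      have ex := congrFun (congrFun (congrFun (congrFun e x) z) (Sum.inl β)) (Sum.inr m)
      simp only [Pi.sub_apply, Pi.smul_apply] at hx ex ⊢
      rw [show actB Lc α (fun κ u κ' u' => cB • T κ u κ' u') = actB Lc α (cB • T) from rfl, actB_smul]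
      simp only [Pi.smul_apply, bdB_inl_inr, Bwall] at ex ⊢
      linarith
  constructor
  · intro h α κ u κ' u' x z β m
    exact (key α κ u κ' u' β m).1 (fun x z => h α κ u κ' u' x z β m) x z
  · intro h α κ u κ' u' x z β m
    exact (key α κ u κ' u' β m).2 (fun x z => h α κ u κ' u' x z β m) x z

/-! ## §4 The candidate row table: the anti-twin, symmetrised packing of an1's second-order border table -/

/-- [our object] **ANTI-TWIN PROJECTION** of a kernel: keep the field–multiplier block, put MINUS its twin on the multiplier–field block, zero elsewhere. -/
def atw (K : MKer (d + 1) (Fib d)) : MKer (d + 1) (Fib d) :=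
  fun x z a b =>
    match a, b with
    | Sum.inl _, Sum.inr _ => K x z a b
    | Sum.inr m, Sum.inl β => -K z x (Sum.inl β) (Sum.inr m)
    | Sum.inl _, Sum.inl _ => 0
    | Sum.inr _, Sum.inr _ => 0

/-- [our object] **THE CANDIDATE ROW BORDER TABLE** (owner NOTE X-an2-46's prescription; NOT asserted to be Bałaban's jet here): the anti-twin packing of the
`(g,h)`-symmetrisation of an1's twin-packed second-order border table `vh₂SAt ρ_c Lc`. -/
def vh₂SAn1 (Lc : ℕ) : Fin 4 → (Fin 4 → ℤ) → Fin 4 → (Fin 4 → ℤ) → MKer 4 (Fib 3) :=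
  fun κ u κ' u' => atw ((1 / 2 : ℝ) • (vh₂SAt (toSite (ctrOff 4 Lc)) Lc κ u κ' u' + vh₂SAt (toSite (ctrOff 4 Lc)) Lc κ' u' κ u))

omit [NeZero Lc] in
/-- [folklore] The candidate has no field–field block. -/
theorem vh₂SAn1_inl_inl (κ : Fin 4) (u : Fin 4 → ℤ) (κ' : Fin 4) (u' x z : Fin 4 → ℤ) (β β' : Fin 4) :
    vh₂SAn1 Lc κ u κ' u' x z (Sum.inl β) (Sum.inl β') = 0 := rfl

omit [NeZero Lc] in
/-- [folklore] The candidate has no multiplier–multiplier block. -/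
theorem vh₂SAn1_inr_inr (κ : Fin 4) (u : Fin 4 → ℤ) (κ' : Fin 4) (u' x z : Fin 4 → ℤ) (m m' : Fin 4) :
    vh₂SAn1 Lc κ u κ' u' x z (Sum.inr m) (Sum.inr m') = 0 := rfl

omit [NeZero Lc] in
/-- [folklore] The candidate is anti-twin on the border. -/
theorem vh₂SAn1_antiTwin (κ : Fin 4) (u : Fin 4 → ℤ) (κ' : Fin 4) (u' x z : Fin 4 → ℤ) (β m : Fin 4) :
    vh₂SAn1 Lc κ u κ' u' z x (Sum.inr m) (Sum.inl β) = -vh₂SAn1 Lc κ u κ' u' x z (Sum.inl β) (Sum.inr m) := rfl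

omit [NeZero Lc] in
/-- [folklore] The candidate is symmetric in the two jet bonds. -/
theorem vh₂SAn1_swap (κ : Fin 4) (u : Fin 4 → ℤ) (κ' : Fin 4) (u' : Fin 4 → ℤ) : vh₂SAn1 Lc κ u κ' u' = vh₂SAn1 Lc κ' u' κ u := by
  funext x z a b
  rcases a with β | m <;> rcases b with β' | m' <;> simp [vh₂SAn1, atw, add_comm]

/-- [folklore] **THE ROW's BORDER LETTER AS A NAMED TARGET**: the candidate satisfies the hR END's border letter at level `0` (weight `cB ≠ 0`)
iff `cB•vh₂SAn1 − Twall` is reflection-invariant on the field–multiplier block under all four axes. -/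
theorem borderAt_zero_an1_iff (hLc : Odd Lc) (cΛ cB : ℝ) (γ : ℕ → ℝ)
    (hγ : ∀ j, γ j = -((Lc : ℝ) ^ 8 / 2) * wVH 3 Lc j / (stepScale 3 Lc j * (Lc : ℝ) ^ 4)) :
    BorderAt Lc (toSite (ctrOff 4 Lc)) cΛ cB γ (vh₂SAn1 Lc) 0 ↔
      ∀ (α κ : Fin 4) (u : Fin 4 → ℤ) (κ' : Fin 4) (u' x z : Fin 4 → ℤ) (β m : Fin 4),
        (actB Lc α (cB • vh₂SAn1 Lc - Twall Lc cΛ γ) - (cB • vh₂SAn1 Lc - Twall Lc cΛ γ)) κ u κ' u' x z (Sum.inl β) (Sum.inr m) = 0 :=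
  borderAt_zero_iff_sub_Twall hLc cΛ cB γ hγ (vh₂SAn1 Lc)

end Wall

end

end Summit.QuantumFields.BalabanUV.Beta.SecondOrderSocketIdentification
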